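import Summits.Ventures.Crystal3D.Theorems.StickyWulffConstantTextureLiminfTexShadowSteepPlateDefs
import Summits.Ventures.Crystal3D.Theorems.StickyWulffConstantTextureLiminfTexShadowCoverageBarlowSteer2WideGlue
import HarnessLib

/-!
# TexShadow row (e) / EDGE-ON: the v8.7 SPLIT of the shrunken edge-on stub along the steep-plate corner (`edgeOnS_of_steepSplit`)
# (lane T, crux `TextureLiminfV5`, stmt-Ventures-23912, sub-crux EDGE-ON `stub_edgeOnS`; cf-p1 DECISION (cxlvii)(1)(b)/(2); 19480-p2 g12)

HONEST FRAMING. Venture `Summits/Ventures/Crystal3D` (cell `crystal3d-full`), route `route-Ventures-StickyWulffConstant`, helper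
`--supports` the law-v5 crux `TextureLiminfV5` (stmt-Ventures-23912).  PURE BOOKKEEPING (census-free, standard axioms); no certificate and no
wall statement is proved; rung F-C1 not moved.

WHAT.  v8.6 registers `stub_edgeOnS : ∃ C, …CoreOnAt (EdgeOnAt (13/25) ∧ ¬BarlowMenuSteer2WideCertified (13/25)) (13/25) C 10` (the edge-on pairs the
two-sided wide-steered ledger does not certify).  19480-p1's closed form of the ledger's LAUNCH-FAILURE set is `SteepPairAt (1/3) σ₁ σ₂ L₁ L₂`
(`…TexShadowSteepPlateDefs`, p706442: some plate has no up-slot of `±e₃`-rise `≥ steerSteepCos (1/3) = (17√2 − √70)/36`; `not_twoSidedSteerWide_of_steepPairAt`: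
such pairs are certified by NO steering).  v8.7 (cf-p1 (cxlvii)(2)) splits `stub_edgeOnS` along it:
* **`stub_edgeOnSteep`** — `EdgeOnAt ∧ SteepPairAt (1/3) ∧ ¬Menu₂`: THE MECHANISM CORNER (≤ 5.55 % of H; owner = the mechanism front);
* **`stub_edgeOnResidue`** — `EdgeOnAt ∧ ¬SteepPairAt (1/3) ∧ ¬Menu₂`: separation-(iii)_z ∪ reads ∪ flux-short (kernel-reachable bookkeeping).
This file is the union glue:
* `residualFaultedCoreOnAt_of_steepSplit` — generic `c₀, c, R₀`: cores on `Rem ∧ SteepPairAt c` and on `Rem ∧ ¬SteepPairAt c` give the core on `Rem`;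
* **`edgeOnS_of_steepSplit`** — the registration shape at `(13/25, 1/3, 10)`:
  `(∃ C, …CoreOnAt (EdgeOn ∧ SteepPair ∧ ¬Menu₂) (13/25) C 10) → (∃ C, …CoreOnAt (EdgeOn ∧ ¬SteepPair ∧ ¬Menu₂) (13/25) C 10) → ∃ C, …CoreOnAt (EdgeOn ∧ ¬Menu₂) (13/25) C 10`;
* `edgeOnSteep_of_edgeOnS` / `edgeOnResidue_of_edgeOnS` — monotonicity (v8.6's stub implies both pieces: the re-cut loses nothing);
* `stub_edgeOn_of_steepSplit` — the FROZEN `stub_edgeOn` statement straight from the two v8.7 pieces (via `edgeOn_of_steer2Cut`).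
WHAT THIS IS NOT: no certificate, no mechanism; F-C1 not moved.
-/

noncomputable section

namespace Summit.Ventures.Crystal3D.Cruxes.TextureLiminf.TexShadow

open Summit.Ventures.Crystal3D Summit.Ventures.Crystal3D.Theorems
open Literature.MathematicalPhysics.StatisticalMechanics (IsHaggSeq)
open scoped InnerProductSpace

/-- **Split of a remainder core along the steep-pair corner** (generic): the cores on `Rem ∧ SteepPairAt c` (constant `C₁`) and on
`Rem ∧ ¬SteepPairAt c` (constant `C₂`) give the core on `Rem` at `max C₁ C₂` (`R₀ ≥ 0`). -/
theorem residualFaultedCoreOnAt_of_steepSplit {Rem : (ℤ → ℤ) → (ℤ → ℤ) → (E3 ≃ₗᵢ[ℝ] E3) → (E3 ≃ₗᵢ[ℝ] E3) → Prop}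
    {c₀ c C₁ C₂ R₀ : ℝ} (hR₀ : 0 ≤ R₀)
    (h₁ : BilayerWallResidualFaultedCoreOnAt (fun σ₁ σ₂ L₁ L₂ => Rem σ₁ σ₂ L₁ L₂ ∧ SteepPairAt c σ₁ σ₂ L₁ L₂) c₀ C₁ R₀)
    (h₂ : BilayerWallResidualFaultedCoreOnAt (fun σ₁ σ₂ L₁ L₂ => Rem σ₁ σ₂ L₁ L₂ ∧ ¬ SteepPairAt c σ₁ σ₂ L₁ L₂) c₀ C₂ R₀) :
    BilayerWallResidualFaultedCoreOnAt Rem c₀ (max C₁ C₂) R₀ :=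
  residualFaultedCoreOnAt_anti
    (Rem := fun σ₁ σ₂ L₁ L₂ =>
      (Rem σ₁ σ₂ L₁ L₂ ∧ SteepPairAt c σ₁ σ₂ L₁ L₂) ∨ (Rem σ₁ σ₂ L₁ L₂ ∧ ¬ SteepPairAt c σ₁ σ₂ L₁ L₂))
    (fun σ₁ σ₂ L₁ L₂ hrem => by
      by_cases hs : SteepPairAt c σ₁ σ₂ L₁ L₂
      · exact Or.inl ⟨hrem, hs⟩
      · exact Or.inr ⟨hrem, hs⟩)
    (residualFaultedCoreOnAt_union hR₀ h₁ h₂)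

/-- **`edgeOnS_of_steepSplit` — THE v8.7 SPLIT GLUE** (cf-p1 (cxlvii)(1)(b)): the steep-corner core
`stub_edgeOnSteep : ∃ C, …CoreOnAt (EdgeOnAt (13/25) ∧ SteepPairAt (1/3) ∧ ¬BarlowMenuSteer2WideCertified (13/25)) (13/25) C 10` and the residue core
`stub_edgeOnResidue : ∃ C, …CoreOnAt (EdgeOnAt (13/25) ∧ ¬SteepPairAt (1/3) ∧ ¬BarlowMenuSteer2WideCertified (13/25)) (13/25) C 10` give v8.6's
`stub_edgeOnS : ∃ C, …CoreOnAt (EdgeOnAt (13/25) ∧ ¬BarlowMenuSteer2WideCertified (13/25)) (13/25) C 10`. -/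
theorem edgeOnS_of_steepSplit
    (hsteep : ∃ C : ℝ, BilayerWallResidualFaultedCoreOnAt
      (fun σ₁ σ₂ L₁ L₂ => EdgeOnAt (13 / 25) σ₁ σ₂ L₁ L₂ ∧ SteepPairAt (1 / 3) σ₁ σ₂ L₁ L₂ ∧
        ¬ BarlowMenuSteer2WideCertified (13 / 25) σ₁ σ₂ L₁ L₂) (13 / 25) C 10)
    (hres : ∃ C : ℝ, BilayerWallResidualFaultedCoreOnAt
      (fun σ₁ σ₂ L₁ L₂ => EdgeOnAt (13 / 25) σ₁ σ₂ L₁ L₂ ∧ ¬ SteepPairAt (1 / 3) σ₁ σ₂ L₁ L₂ ∧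
        ¬ BarlowMenuSteer2WideCertified (13 / 25) σ₁ σ₂ L₁ L₂) (13 / 25) C 10) :
    ∃ C : ℝ, BilayerWallResidualFaultedCoreOnAt
      (fun σ₁ σ₂ L₁ L₂ => EdgeOnAt (13 / 25) σ₁ σ₂ L₁ L₂ ∧ ¬ BarlowMenuSteer2WideCertified (13 / 25) σ₁ σ₂ L₁ L₂) (13 / 25) C 10 := by
  obtain ⟨C₁, h₁⟩ := hsteep
  obtain ⟨C₂, h₂⟩ := hres
  refine ⟨max C₁ C₂, residualFaultedCoreOnAt_of_steepSplit (c := 1 / 3) (by norm_num) ?_ ?_⟩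
  · exact residualFaultedCoreOnAt_anti (fun _ _ _ _ hx => ⟨hx.1.1, hx.2, hx.1.2⟩) h₁
  · exact residualFaultedCoreOnAt_anti (fun _ _ _ _ hx => ⟨hx.1.1, hx.2, hx.1.2⟩) h₂

/-! ## Monotonicity: v8.6's stub implies both v8.7 pieces -/

/-- The shrunken edge-on core gives the steep-corner core. -/
theorem edgeOnSteep_of_edgeOnS {c₀ c C R₀ : ℝ}
    (h : BilayerWallResidualFaultedCoreOnAt
      (fun σ₁ σ₂ L₁ L₂ => EdgeOnAt c₀ σ₁ σ₂ L₁ L₂ ∧ ¬ BarlowMenuSteer2WideCertified c₀ σ₁ σ₂ L₁ L₂) c₀ C R₀) :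
    BilayerWallResidualFaultedCoreOnAt
      (fun σ₁ σ₂ L₁ L₂ => EdgeOnAt c₀ σ₁ σ₂ L₁ L₂ ∧ SteepPairAt c σ₁ σ₂ L₁ L₂ ∧ ¬ BarlowMenuSteer2WideCertified c₀ σ₁ σ₂ L₁ L₂)
      c₀ C R₀ :=
  residualFaultedCoreOnAt_anti (fun _ _ _ _ hx => ⟨hx.1, hx.2.2⟩) h

/-- The shrunken edge-on core gives the residue core. -/
theorem edgeOnResidue_of_edgeOnS {c₀ c C R₀ : ℝ}
    (h : BilayerWallResidualFaultedCoreOnAt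
      (fun σ₁ σ₂ L₁ L₂ => EdgeOnAt c₀ σ₁ σ₂ L₁ L₂ ∧ ¬ BarlowMenuSteer2WideCertified c₀ σ₁ σ₂ L₁ L₂) c₀ C R₀) :
    BilayerWallResidualFaultedCoreOnAt
      (fun σ₁ σ₂ L₁ L₂ => EdgeOnAt c₀ σ₁ σ₂ L₁ L₂ ∧ ¬ SteepPairAt c σ₁ σ₂ L₁ L₂ ∧ ¬ BarlowMenuSteer2WideCertified c₀ σ₁ σ₂ L₁ L₂)
      c₀ C R₀ :=
  residualFaultedCoreOnAt_anti (fun _ _ _ _ hx => ⟨hx.1, hx.2.2⟩) h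

/-! ## The frozen `stub_edgeOn` straight from the v8.7 pieces -/

/-- **The FROZEN `stub_edgeOn` statement from the two v8.7 stubs** (`edgeOnS_of_steepSplit` then `edgeOn_of_steer2Cut`). -/
theorem stub_edgeOn_of_steepSplit (hE1 : P5Exhaustion) (hSP : StarPairFar)
    (hsteep : ∃ C : ℝ, BilayerWallResidualFaultedCoreOnAt
      (fun σ₁ σ₂ L₁ L₂ => EdgeOnAt (13 / 25) σ₁ σ₂ L₁ L₂ ∧ SteepPairAt (1 / 3) σ₁ σ₂ L₁ L₂ ∧
        ¬ BarlowMenuSteer2WideCertified (13 / 25) σ₁ σ₂ L₁ L₂) (13 / 25) C 10)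
    (hres : ∃ C : ℝ, BilayerWallResidualFaultedCoreOnAt
      (fun σ₁ σ₂ L₁ L₂ => EdgeOnAt (13 / 25) σ₁ σ₂ L₁ L₂ ∧ ¬ SteepPairAt (1 / 3) σ₁ σ₂ L₁ L₂ ∧
        ¬ BarlowMenuSteer2WideCertified (13 / 25) σ₁ σ₂ L₁ L₂) (13 / 25) C 10) :
    ∃ C : ℝ, BilayerWallResidualFaultedEdgeOnAt (13 / 25) C 10 :=
  edgeOn_of_steer2Cut hE1 hSP (edgeOnS_of_steepSplit hsteep hres)

end Summit.Ventures.Crystal3D.Cruxes.TextureLiminf.TexShadow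

end
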